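import Mathlib
import HarnessLib
import Summits.HubbardSuperconductivity.HubbardSuperconductivity.Theorems.KLProgrammeKLRegimeVolumeLimitCauchyTermwise

/-!
# Route `KLProgramme` — VL child `KLRegimeVolumeLimitV12` (stmt-HubbardSuperconductivity-19858), Cauchy stub `stub_vl_twoVolumeRate`:
# more RATE ALGEBRA — iterated limits of scalar volume families give threshold rates; products, differences, constants, thresholds
# (cell gate-hubbard-kl, seat hubbard-kl-k3c4-p1 g4; sequel of `…VolumeLimitCauchyTermwise` §4 (sum / grid-exact / dressing rules))

The registered Cauchy stub of the VL skeleton «cauchy» asks, for a volume family `S L M : FreqMomentum L M → Fin 2 → ℂ`, for thresholds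
`(L₀, Mth)`, a modulus constant `D` and a rate `ρ → 0` with
`‖S_{L,M}((ω,k),σ) − S_{L′,M′}((ω′,k′),σ)‖ ≤ ρ L + D·Σ_i |p_k i − p′_{k′} i|_𝕋` (`L₀ ≤ L ≤ L′`, `Mth L ≤ M`, `Mth L′ ≤ M′`, equal Matsubara
integers).  This file adds to the rate algebra of `…CauchyTermwise` the rules needed to assemble the order-`U²` rung of the TRUE carrier
(`…VolumeLimitSecondOrderRate`) from the pieces the k3c5 lane evaluated (`S₁ = −dress²·t`, `S₂ = 2·dress²·(sunset − ĝ₀·t² − t·t₂)`):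

* `exists_thresholdRate_of_iterLimit` — **an ITERATED LIMIT yields a THRESHOLD RATE**: if a scalar volume family `a L M` converges to `a∞`
  «eventually in `L`, then in `M`» (`∀ ε>0 ∃ L₁ ∀ L ≥ L₁ ∃ M₁ ∀ M ≥ M₁, ‖a L M − a∞‖ ≤ ε` — the shape of the k3c5 lane's
  `tadpoleAvg_iterLimit` / `sqAvg_iterLimit`), then there are `L₀`, `Mth : ℕ → ℕ` and an ANTITONE `ρ → 0` with `‖a L M − a∞‖ ≤ ρ L` for all
  `L ≥ L₀`, `M ≥ Mth L` (choice along `ε_j = 1/(j+1)`, `j(L)` = the largest `j ≤ L` whose `L`-threshold envelope is `≤ L`);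
* `twoVolumeRate_of_iterLimit` — hence a momentum-constant family with an iterated limit obeys the stub's inequality with `D = 0`, `ρ = 2ρ₀`;
* `twoVolumeRate_mono` (enlarge thresholds), `twoVolumeRate_const_mul`, `twoVolumeRate_neg`, `twoVolumeRate_sub`,
  `twoVolumeRate_mul` (two rated BOUNDED families: rate `B_T ρ_S + B_S ρ_T`, modulus `B_T D_S + B_S D_T`).

Pure bookkeeping (Mathlib); nothing is asserted about the model.
-/

noncomputable section

namespace Summit.HubbardSuperconductivity.HubbardSuperconductivity.Theorems.KLRegimeSplit

set_option linter.dupNamespace false -- summit = problem name (single-conjunct summit), D-0017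

open Filter Topology Finset Literature.MathematicalPhysics.QuantumLattice Literature.Probability.LatticeModels
open Summit.HubbardSuperconductivity.HubbardSuperconductivity.Theorems.KLProgrammeLegKernels

/-! ## §1 An iterated limit yields a threshold rate -/

/-- **Iterated limit ⇒ threshold rate.**  If `a L M → a∞` eventually in `L` then in `M`, there are `L₀`, `Mth : ℕ → ℕ` and an antitone
nonnegative `ρ → 0` with `‖a L M − a∞‖ ≤ ρ L` for all `L ≥ L₀`, `M ≥ Mth L`. [folklore] -/
theorem exists_thresholdRate_of_iterLimit {a : ∀ (L M : ℕ) [NeZero L] [NeZero M], ℂ} {aInf : ℂ}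
    (hl : ∀ ε : ℝ, 0 < ε → ∃ L₁ : ℕ, ∀ (L : ℕ) [NeZero L], L₁ ≤ L →
      ∃ M₁ : ℕ, ∀ (M : ℕ) [NeZero M], M₁ ≤ M → ‖a L M - aInf‖ ≤ ε) :
    ∃ L₀ : ℕ, ∃ Mth : ℕ → ℕ, ∃ ρ : ℕ → ℝ, Tendsto ρ atTop (𝓝 0) ∧ (∀ L, 0 ≤ ρ L) ∧ Antitone ρ ∧
      ∀ (L : ℕ) [NeZero L], L₀ ≤ L → ∀ (M : ℕ) [NeZero M], Mth L ≤ M → ‖a L M - aInf‖ ≤ ρ L := by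
  classical
  have hε : ∀ j : ℕ, (0 : ℝ) < 1 / ((j : ℝ) + 1) := fun j => by positivity
  choose L₁ hL₁ using fun j : ℕ => hl (1 / ((j : ℝ) + 1)) (hε j)
  -- monotone envelope of the `L`-thresholds
  set N : ℕ → ℕ := fun j => (Finset.range (j + 1)).sup L₁ with hN
  have hNL : ∀ j, L₁ j ≤ N j := fun j => Finset.le_sup (f := L₁) (Finset.mem_range.2 (Nat.lt_succ_self j))
  -- the index selector: the largest `j ≤ L` with `N j ≤ L`
  set J : ℕ → ℕ := fun L => Nat.findGreatest (fun j => N j ≤ L) L with hJ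
  have hJmono : Monotone J := fun L L' hLL' =>
    Nat.findGreatest_mono (fun j (hj : N j ≤ L) => hj.trans hLL') hLL'
  have hJspec : ∀ L, N 0 ≤ L → N (J L) ≤ L := fun L hL =>
    Nat.findGreatest_spec (P := fun j => N j ≤ L) (Nat.zero_le L) hL
  have hJge : ∀ j L, j ≤ L → N j ≤ L → j ≤ J L := fun j L hjL hNj => Nat.le_findGreatest hjL hNj
  -- the rate
  set ρ : ℕ → ℝ := fun L => 1 / ((J L : ℝ) + 1) with hρ
  have hρ0 : ∀ L, 0 ≤ ρ L := fun L => by positivity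
  have hρanti : Antitone ρ := by
    intro L L' hLL'
    have h : (J L : ℝ) + 1 ≤ (J L' : ℝ) + 1 := by
      have := hJmono hLL'
      exact_mod_cast Nat.succ_le_succ this
    exact one_div_le_one_div_of_le (by positivity) h
  have hρlim : Tendsto ρ atTop (𝓝 0) := by
    rw [Metric.tendsto_atTop]
    intro ε hεpos
    obtain ⟨j, hj⟩ := exists_nat_one_div_lt hεpos
    refine ⟨max j (N j), fun L hL => ?_⟩
    have hjL : j ≤ L := (le_max_left _ _).trans hL
    have hNjL : N j ≤ L := (le_max_right _ _).trans hL
    have hJL : j ≤ J L := hJge j L hjL hNjL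
    rw [Real.dist_eq, sub_zero, abs_of_nonneg (hρ0 L)]
    calc ρ L = 1 / ((J L : ℝ) + 1) := rfl
      _ ≤ 1 / ((j : ℝ) + 1) := one_div_le_one_div_of_le (by positivity) (by exact_mod_cast Nat.succ_le_succ hJL)
      _ < ε := hj
  -- the `M`-thresholds (choice, for `L ≥ N 0`, `L ≠ 0`)
  have hreach : ∀ L, L ≠ 0 ∧ N 0 ≤ L → L₁ (J L) ≤ L := fun L h => (hNL _).trans (hJspec L h.2)
  set Mth : ℕ → ℕ := fun L =>
    if h : L ≠ 0 ∧ N 0 ≤ L then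
      (by haveI : NeZero L := ⟨h.1⟩; exact Classical.choose (hL₁ (J L) L (hreach L h)))
    else 0 with hMth
  refine ⟨N 0, Mth, ρ, hρlim, hρ0, hρanti, fun L _ hL M _ hM => ?_⟩
  have h : L ≠ 0 ∧ N 0 ≤ L := ⟨NeZero.ne L, hL⟩
  have hspec := Classical.choose_spec (hL₁ (J L) L (hreach L h))
  have hMth_eq : Mth L = Classical.choose (hL₁ (J L) L (hreach L h)) := by
    simp only [hMth, dif_pos h]
  rw [hMth_eq] at hM
  exact hspec M hM

/-- **A momentum-constant family with an iterated limit obeys the Cauchy stub's inequality** (`D = 0`, rate `2ρ`): for the family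
`(L, M, k, σ) ↦ a L M`. [folklore] -/
theorem twoVolumeRate_of_iterLimit {a : ∀ (L M : ℕ) [NeZero L] [NeZero M], ℂ} {aInf : ℂ}
    (hl : ∀ ε : ℝ, 0 < ε → ∃ L₁ : ℕ, ∀ (L : ℕ) [NeZero L], L₁ ≤ L →
      ∃ M₁ : ℕ, ∀ (M : ℕ) [NeZero M], M₁ ≤ M → ‖a L M - aInf‖ ≤ ε) :
    ∃ L₀ : ℕ, ∃ Mth : ℕ → ℕ, ∃ ρ : ℕ → ℝ, Tendsto ρ atTop (𝓝 0) ∧ (∀ L, 0 ≤ ρ L) ∧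
      ∀ (L : ℕ) [NeZero L], L₀ ≤ L → ∀ (M : ℕ) [NeZero M], Mth L ≤ M →
        ∀ (L' : ℕ) [NeZero L'], L ≤ L' → ∀ (M' : ℕ) [NeZero M'], Mth L' ≤ M' →
          ∀ (_σ : Fin 2) (ω : MatsubaraIdx M) (ω' : MatsubaraIdx M'), matsubaraInt M ω = matsubaraInt M' ω' →
            ∀ (k : TorusSite 2 L) (k' : TorusSite 2 L'),
              ‖a L M - a L' M'‖ ≤ ρ L + 0 * ∑ i, torusAbs (latticeMomentum L k i - latticeMomentum L' k' i) := by
  obtain ⟨L₀, Mth, ρ, hρ, hρ0, hanti, h⟩ := exists_thresholdRate_of_iterLimit hl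
  refine ⟨L₀, Mth, fun L => 2 * ρ L, by simpa using hρ.const_mul 2, fun L => by have := hρ0 L; positivity, ?_⟩
  intro L _ hL M _ hM L' _ hLL' M' _ hM' _ _ _ _ k k'
  rw [zero_mul, add_zero]
  have h1 := h L hL M hM
  have h2 := h L' (hL.trans hLL') M' hM'
  calc ‖a L M - a L' M'‖ = ‖(a L M - aInf) - (a L' M' - aInf)‖ := by congr 1; ring
    _ ≤ ‖a L M - aInf‖ + ‖a L' M' - aInf‖ := norm_sub_le _ _
    _ ≤ ρ L + ρ L' := add_le_add h1 h2
    _ ≤ ρ L + ρ L := by gcongr; exact hanti hLL'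
    _ = 2 * ρ L := by ring

/-! ## §2 Thresholds, constants, negation, difference, product -/

section Algebra

variable {S T : ∀ (L M : ℕ) [NeZero L] [NeZero M], FreqMomentum L M → Fin 2 → ℂ}

/-- **Enlarging the thresholds** keeps a two-volume rate. [folklore] -/
theorem twoVolumeRate_mono {Mth Mth' : ℕ → ℕ} {L₀ L₀' : ℕ} {D : ℝ} {ρ : ℕ → ℝ} (hL₀ : L₀ ≤ L₀') (hMth : ∀ L, Mth L ≤ Mth' L)
    (hS : ∀ (L : ℕ) [NeZero L], L₀ ≤ L → ∀ (M : ℕ) [NeZero M], Mth L ≤ M →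
      ∀ (L' : ℕ) [NeZero L'], L ≤ L' → ∀ (M' : ℕ) [NeZero M'], Mth L' ≤ M' →
        ∀ (σ : Fin 2) (ω : MatsubaraIdx M) (ω' : MatsubaraIdx M'), matsubaraInt M ω = matsubaraInt M' ω' →
          ∀ (k : TorusSite 2 L) (k' : TorusSite 2 L'),
            ‖S L M (ω, k) σ - S L' M' (ω', k') σ‖ ≤ ρ L + D * ∑ i, torusAbs (latticeMomentum L k i - latticeMomentum L' k' i)) :
    ∀ (L : ℕ) [NeZero L], L₀' ≤ L → ∀ (M : ℕ) [NeZero M], Mth' L ≤ M →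
      ∀ (L' : ℕ) [NeZero L'], L ≤ L' → ∀ (M' : ℕ) [NeZero M'], Mth' L' ≤ M' →
        ∀ (σ : Fin 2) (ω : MatsubaraIdx M) (ω' : MatsubaraIdx M'), matsubaraInt M ω = matsubaraInt M' ω' →
          ∀ (k : TorusSite 2 L) (k' : TorusSite 2 L'),
            ‖S L M (ω, k) σ - S L' M' (ω', k') σ‖ ≤ ρ L + D * ∑ i, torusAbs (latticeMomentum L k i - latticeMomentum L' k' i) :=
  fun L _ hL M _ hM L' _ hLL' M' _ hM' σ ω ω' hωω' k k' =>
    hS L (hL₀.trans hL) M ((hMth L).trans hM) L' hLL' M' ((hMth L').trans hM') σ ω ω' hωω' k k'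

/-- **Constant multiples**: a rate `(ρ, D)` for `S` gives `(‖c‖ρ, ‖c‖D)` for `c·S`. [folklore] -/
theorem twoVolumeRate_const_mul {Mth : ℕ → ℕ} {L₀ : ℕ} {D : ℝ} {ρ : ℕ → ℝ} (c : ℂ)
    (hS : ∀ (L : ℕ) [NeZero L], L₀ ≤ L → ∀ (M : ℕ) [NeZero M], Mth L ≤ M →
      ∀ (L' : ℕ) [NeZero L'], L ≤ L' → ∀ (M' : ℕ) [NeZero M'], Mth L' ≤ M' →
        ∀ (σ : Fin 2) (ω : MatsubaraIdx M) (ω' : MatsubaraIdx M'), matsubaraInt M ω = matsubaraInt M' ω' →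
          ∀ (k : TorusSite 2 L) (k' : TorusSite 2 L'),
            ‖S L M (ω, k) σ - S L' M' (ω', k') σ‖ ≤ ρ L + D * ∑ i, torusAbs (latticeMomentum L k i - latticeMomentum L' k' i)) :
    ∀ (L : ℕ) [NeZero L], L₀ ≤ L → ∀ (M : ℕ) [NeZero M], Mth L ≤ M →
      ∀ (L' : ℕ) [NeZero L'], L ≤ L' → ∀ (M' : ℕ) [NeZero M'], Mth L' ≤ M' →
        ∀ (σ : Fin 2) (ω : MatsubaraIdx M) (ω' : MatsubaraIdx M'), matsubaraInt M ω = matsubaraInt M' ω' →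
          ∀ (k : TorusSite 2 L) (k' : TorusSite 2 L'),
            ‖c * S L M (ω, k) σ - c * S L' M' (ω', k') σ‖ ≤
              (fun L => ‖c‖ * ρ L) L + ‖c‖ * D * ∑ i, torusAbs (latticeMomentum L k i - latticeMomentum L' k' i) := by
  intro L _ hL M _ hM L' _ hLL' M' _ hM' σ ω ω' hωω' k k'
  have h := hS L hL M hM L' hLL' M' hM' σ ω ω' hωω' k k'
  rw [← mul_sub, norm_mul]
  calc ‖c‖ * ‖S L M (ω, k) σ - S L' M' (ω', k') σ‖
      ≤ ‖c‖ * (ρ L + D * ∑ i, torusAbs (latticeMomentum L k i - latticeMomentum L' k' i)) :=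
        mul_le_mul_of_nonneg_left h (norm_nonneg _)
    _ = ‖c‖ * ρ L + ‖c‖ * D * ∑ i, torusAbs (latticeMomentum L k i - latticeMomentum L' k' i) := by ring

/-- **Negation** keeps a two-volume rate. [folklore] -/
theorem twoVolumeRate_neg {Mth : ℕ → ℕ} {L₀ : ℕ} {D : ℝ} {ρ : ℕ → ℝ}
    (hS : ∀ (L : ℕ) [NeZero L], L₀ ≤ L → ∀ (M : ℕ) [NeZero M], Mth L ≤ M →
      ∀ (L' : ℕ) [NeZero L'], L ≤ L' → ∀ (M' : ℕ) [NeZero M'], Mth L' ≤ M' →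
        ∀ (σ : Fin 2) (ω : MatsubaraIdx M) (ω' : MatsubaraIdx M'), matsubaraInt M ω = matsubaraInt M' ω' →
          ∀ (k : TorusSite 2 L) (k' : TorusSite 2 L'),
            ‖S L M (ω, k) σ - S L' M' (ω', k') σ‖ ≤ ρ L + D * ∑ i, torusAbs (latticeMomentum L k i - latticeMomentum L' k' i)) :
    ∀ (L : ℕ) [NeZero L], L₀ ≤ L → ∀ (M : ℕ) [NeZero M], Mth L ≤ M →
      ∀ (L' : ℕ) [NeZero L'], L ≤ L' → ∀ (M' : ℕ) [NeZero M'], Mth L' ≤ M' →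
        ∀ (σ : Fin 2) (ω : MatsubaraIdx M) (ω' : MatsubaraIdx M'), matsubaraInt M ω = matsubaraInt M' ω' →
          ∀ (k : TorusSite 2 L) (k' : TorusSite 2 L'),
            ‖-S L M (ω, k) σ - -S L' M' (ω', k') σ‖ ≤ ρ L + D * ∑ i, torusAbs (latticeMomentum L k i - latticeMomentum L' k' i) := by
  intro L _ hL M _ hM L' _ hLL' M' _ hM' σ ω ω' hωω' k k'
  rw [show -S L M (ω, k) σ - -S L' M' (ω', k') σ = -(S L M (ω, k) σ - S L' M' (ω', k') σ) by ring, norm_neg]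
  exact hS L hL M hM L' hLL' M' hM' σ ω ω' hωω' k k'

/-- **Difference rule**: rates `(ρ₁, D₁)` for `S` and `(ρ₂, D₂)` for `T` give `(ρ₁ + ρ₂, D₁ + D₂)` for `S − T`. [folklore] -/
theorem twoVolumeRate_sub {Mth : ℕ → ℕ} {L₀ : ℕ} {D₁ D₂ : ℝ} {ρ₁ ρ₂ : ℕ → ℝ}
    (hS : ∀ (L : ℕ) [NeZero L], L₀ ≤ L → ∀ (M : ℕ) [NeZero M], Mth L ≤ M →
      ∀ (L' : ℕ) [NeZero L'], L ≤ L' → ∀ (M' : ℕ) [NeZero M'], Mth L' ≤ M' →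
        ∀ (σ : Fin 2) (ω : MatsubaraIdx M) (ω' : MatsubaraIdx M'), matsubaraInt M ω = matsubaraInt M' ω' →
          ∀ (k : TorusSite 2 L) (k' : TorusSite 2 L'),
            ‖S L M (ω, k) σ - S L' M' (ω', k') σ‖ ≤ ρ₁ L + D₁ * ∑ i, torusAbs (latticeMomentum L k i - latticeMomentum L' k' i))
    (hT : ∀ (L : ℕ) [NeZero L], L₀ ≤ L → ∀ (M : ℕ) [NeZero M], Mth L ≤ M →
      ∀ (L' : ℕ) [NeZero L'], L ≤ L' → ∀ (M' : ℕ) [NeZero M'], Mth L' ≤ M' →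
        ∀ (σ : Fin 2) (ω : MatsubaraIdx M) (ω' : MatsubaraIdx M'), matsubaraInt M ω = matsubaraInt M' ω' →
          ∀ (k : TorusSite 2 L) (k' : TorusSite 2 L'),
            ‖T L M (ω, k) σ - T L' M' (ω', k') σ‖ ≤ ρ₂ L + D₂ * ∑ i, torusAbs (latticeMomentum L k i - latticeMomentum L' k' i)) :
    ∀ (L : ℕ) [NeZero L], L₀ ≤ L → ∀ (M : ℕ) [NeZero M], Mth L ≤ M →
      ∀ (L' : ℕ) [NeZero L'], L ≤ L' → ∀ (M' : ℕ) [NeZero M'], Mth L' ≤ M' →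
        ∀ (σ : Fin 2) (ω : MatsubaraIdx M) (ω' : MatsubaraIdx M'), matsubaraInt M ω = matsubaraInt M' ω' →
          ∀ (k : TorusSite 2 L) (k' : TorusSite 2 L'),
            ‖(S L M (ω, k) σ - T L M (ω, k) σ) - (S L' M' (ω', k') σ - T L' M' (ω', k') σ)‖ ≤
              (fun L => ρ₁ L + ρ₂ L) L + (D₁ + D₂) * ∑ i, torusAbs (latticeMomentum L k i - latticeMomentum L' k' i) := by
  intro L _ hL M _ hM L' _ hLL' M' _ hM' σ ω ω' hωω' k k'
  have h₁ := hS L hL M hM L' hLL' M' hM' σ ω ω' hωω' k k'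
  have h₂ := hT L hL M hM L' hLL' M' hM' σ ω ω' hωω' k k'
  calc ‖(S L M (ω, k) σ - T L M (ω, k) σ) - (S L' M' (ω', k') σ - T L' M' (ω', k') σ)‖
      = ‖(S L M (ω, k) σ - S L' M' (ω', k') σ) - (T L M (ω, k) σ - T L' M' (ω', k') σ)‖ := by congr 1; abel
    _ ≤ ‖S L M (ω, k) σ - S L' M' (ω', k') σ‖ + ‖T L M (ω, k) σ - T L' M' (ω', k') σ‖ := norm_sub_le _ _
    _ ≤ _ := by
        have := add_le_add h₁ h₂
        simpa only [add_mul] using this.trans_eq (by ring)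

/-- **Product rule**: two rated families BOUNDED by `B_S`, `B_T` beyond the thresholds have the product rate
`(B_T ρ_S + B_S ρ_T, B_T D_S + B_S D_T)`. [folklore] -/
theorem twoVolumeRate_mul {Mth : ℕ → ℕ} {L₀ : ℕ} {BS BT D₁ D₂ : ℝ} {ρ₁ ρ₂ : ℕ → ℝ} (hBS : 0 ≤ BS)
    (hbS : ∀ (L : ℕ) [NeZero L], L₀ ≤ L → ∀ (M : ℕ) [NeZero M], Mth L ≤ M → ∀ (k : FreqMomentum L M) (σ : Fin 2), ‖S L M k σ‖ ≤ BS)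
    (hbT : ∀ (L : ℕ) [NeZero L], L₀ ≤ L → ∀ (M : ℕ) [NeZero M], Mth L ≤ M → ∀ (k : FreqMomentum L M) (σ : Fin 2), ‖T L M k σ‖ ≤ BT)
    (hS : ∀ (L : ℕ) [NeZero L], L₀ ≤ L → ∀ (M : ℕ) [NeZero M], Mth L ≤ M →
      ∀ (L' : ℕ) [NeZero L'], L ≤ L' → ∀ (M' : ℕ) [NeZero M'], Mth L' ≤ M' →
        ∀ (σ : Fin 2) (ω : MatsubaraIdx M) (ω' : MatsubaraIdx M'), matsubaraInt M ω = matsubaraInt M' ω' →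
          ∀ (k : TorusSite 2 L) (k' : TorusSite 2 L'),
            ‖S L M (ω, k) σ - S L' M' (ω', k') σ‖ ≤ ρ₁ L + D₁ * ∑ i, torusAbs (latticeMomentum L k i - latticeMomentum L' k' i))
    (hT : ∀ (L : ℕ) [NeZero L], L₀ ≤ L → ∀ (M : ℕ) [NeZero M], Mth L ≤ M →
      ∀ (L' : ℕ) [NeZero L'], L ≤ L' → ∀ (M' : ℕ) [NeZero M'], Mth L' ≤ M' →
        ∀ (σ : Fin 2) (ω : MatsubaraIdx M) (ω' : MatsubaraIdx M'), matsubaraInt M ω = matsubaraInt M' ω' →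
          ∀ (k : TorusSite 2 L) (k' : TorusSite 2 L'),
            ‖T L M (ω, k) σ - T L' M' (ω', k') σ‖ ≤ ρ₂ L + D₂ * ∑ i, torusAbs (latticeMomentum L k i - latticeMomentum L' k' i)) :
    ∀ (L : ℕ) [NeZero L], L₀ ≤ L → ∀ (M : ℕ) [NeZero M], Mth L ≤ M →
      ∀ (L' : ℕ) [NeZero L'], L ≤ L' → ∀ (M' : ℕ) [NeZero M'], Mth L' ≤ M' →
        ∀ (σ : Fin 2) (ω : MatsubaraIdx M) (ω' : MatsubaraIdx M'), matsubaraInt M ω = matsubaraInt M' ω' →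
          ∀ (k : TorusSite 2 L) (k' : TorusSite 2 L'),
            ‖S L M (ω, k) σ * T L M (ω, k) σ - S L' M' (ω', k') σ * T L' M' (ω', k') σ‖ ≤
              (fun L => BT * ρ₁ L + BS * ρ₂ L) L +
                (BT * D₁ + BS * D₂) * ∑ i, torusAbs (latticeMomentum L k i - latticeMomentum L' k' i) := by
  intro L _ hL M _ hM L' _ hLL' M' _ hM' σ ω ω' hωω' k k'
  set x : ℝ := ∑ i, torusAbs (latticeMomentum L k i - latticeMomentum L' k' i) with hx
  have h₁ := hS L hL M hM L' hLL' M' hM' σ ω ω' hωω' k k'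
  have h₂ := hT L hL M hM L' hLL' M' hM' σ ω ω' hωω' k k'
  have hb₁ := hbS L' (hL.trans hLL') M' hM' (ω', k') σ
  have hb₂ := hbT L hL M hM (ω, k) σ
  have hρ₁x : 0 ≤ ρ₁ L + D₁ * x := (norm_nonneg _).trans h₁
  calc ‖S L M (ω, k) σ * T L M (ω, k) σ - S L' M' (ω', k') σ * T L' M' (ω', k') σ‖
      = ‖(S L M (ω, k) σ - S L' M' (ω', k') σ) * T L M (ω, k) σ +
          S L' M' (ω', k') σ * (T L M (ω, k) σ - T L' M' (ω', k') σ)‖ := by congr 1; ring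
    _ ≤ ‖S L M (ω, k) σ - S L' M' (ω', k') σ‖ * ‖T L M (ω, k) σ‖ +
          ‖S L' M' (ω', k') σ‖ * ‖T L M (ω, k) σ - T L' M' (ω', k') σ‖ := by
        refine (norm_add_le _ _).trans ?_
        rw [norm_mul, norm_mul]
    _ ≤ (ρ₁ L + D₁ * x) * BT + BS * (ρ₂ L + D₂ * x) :=
        add_le_add (mul_le_mul h₁ hb₂ (norm_nonneg _) hρ₁x) (mul_le_mul hb₁ h₂ (norm_nonneg _) hBS)
    _ = (BT * ρ₁ L + BS * ρ₂ L) + (BT * D₁ + BS * D₂) * x := by ring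

end Algebra

end Summit.HubbardSuperconductivity.HubbardSuperconductivity.Theorems.KLRegimeSplit

end
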